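import Mathlib.Analysis.Calculus.Deriv.Mul
import Mathlib.Analysis.Calculus.Deriv.Add
import Mathlib.Analysis.Calculus.Deriv.Comp
import Mathlib.Analysis.SpecialFunctions.Complex.LogDeriv
import Mathlib.Analysis.SpecialFunctions.Log.Deriv
import Mathlib.Analysis.Matrix.PosDef
import Mathlib.LinearAlgebra.Matrix.NonsingularInverse
import Mathlib.LinearAlgebra.Matrix.Hermitian
import Mathlib.LinearAlgebra.Matrix.Trace
import HarnessLib

/-!
# Gradients of `log det ℳ` and of the pseudofermion action along a one-parameter family:
# Jacobi's formula `d/ds log det ℳ = tr(ℳ⁻¹ ℳ′)`, `d/ds ℳ⁻¹ = −ℳ⁻¹ ℳ′ ℳ⁻¹`, and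
# `d/ds(−φ†ℳ⁻¹φ) = η†ℳ′η`, `η = ℳ⁻¹φ`

Topic `Analysis/Matrix`.  PUBLISHED RESULTS with our proofs; no definition and no named fact is
introduced (D-0026).  Wanted by the cell pub-lqcd (venture `LatticeQCDFlow`, HOME/R2-SCOPE.md §3 E7
"training ledger counts every solve/determinant call made during training (P5: 'Gradients of the
fermion determinant are estimated stochastically')", §2 D4 (flow-inside-HMC: "fermions through standard
pseudofermion heat-bath + forces"), §4 cost classes ("2 + n_MD force solves per trajectory"); FANOUT
row 38).  Companion of `Literature/MathematicalPhysics/QuantumLattice/RationalHybridMonteCarlo.lean`,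
whose honest-scope paragraph lists "forces" among the things it does NOT treat, of
`Literature/Analysis/Matrix/DetExp.lean` (Jacobi's formula at the identity along `t ↦ exp(tX)`), and of
`Literature/MathematicalPhysics/QuantumLattice/FermionGammaDerivative.lean` (the Leibniz-expanded
derivative of `det` along an entrywise differentiable path, for `ℂ`; restated here for `RCLike 𝕜` as
`hasDerivAt_det_leibniz` so that this file imports Mathlib only).

## Source and what is taken from it

M. S. Albergo, G. Kanwar, S. Racanière, D. J. Rezende, J. M. Urban, D. Boyda, K. Cranmer,
D. C. Hackett, P. E. Shanahan, *Flow-based sampling for fermionic lattice field theories*,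
Phys. Rev. D 104 (2021) 114507 = arXiv:2106.05934 [AlbergoEtAl2021Fermions], Appendix C
"Stochastic estimator for gradients of `log det ℳ`" (held text `paper:arxiv-2106.05934`, chunk p0022):

> The calculation of loss gradients required for the optimization of some of the models … requires
> the evaluation of gradients `∇_φ log det ℳ(φ)` taken with respect to the field `φ`.  In general,
> `ℳ(φ)` is a positive definite matrix either arising from Dirac matrices of a pair of mass degenerate
> fermions as `ℳ = DD†`, or from one-flavor methods … the following stochastic trace estimator is
> applicable: `∇ log det ℳ(φ) = ∇ Tr log ℳ(φ) = Tr[ℳ(φ)⁻¹ ∇ℳ(φ)] = E_{χ∼e^{−χ†χ}}[(ℳ⁻¹(φ)χ)† ∇ℳ(φ) χ]`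
> (C1). … In the case of two degenerate fermionic flavors, an interesting connection can also be made
> to the gradient of the negative pseudofermion action … `∇(−φ†(DD†)⁻¹φ) = φ†(DD†)⁻¹(∇DD†)(DD†)⁻¹φ
> = η†(∇DD†)η` (C2), where `η ≡ (DD†)⁻¹φ = (D†)⁻¹χ`, in terms of the noise vector `χ ∼ e^{−χ†χ}` used to
> generate the pseudofermion field.  A short derivation shows that this is equivalent to the stochastic
> estimator of the two-flavor determinant,
> `Tr[(DD†)⁻¹(∇DD†)] = Tr[D⁻¹(∇DD†)(D†)⁻¹] = E_χ[((D†)⁻¹χ)†(∇DD†)(D†)⁻¹χ] = E_χ[η†(∇DD†)η]` (C3).  This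
> relation allows the gradient estimator to be computed using the same tools utilized for the
> evaluation of HMC forces with respect to the pseudofermion action.

The gradient `∇_φ` is a family of partial derivatives; each is the derivative along a one-parameter
family `s ↦ ℳ(s)` of matrices, which is the form proved here (entrywise differentiable path
`M : ℝ → Matrix n n 𝕜`, `𝕜 = ℝ` or `ℂ` via `RCLike`, derivative `M′` at `s₀`):

* §1 Jacobi's formula: `hasDerivAt_det_leibniz` (the Leibniz-expanded derivative, any path),
  `hasDerivAt_det_of_eq_one` (`d/ds det ℳ = tr ℳ′` at a point where `ℳ = 1`), **`hasDerivAt_det`**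
  (`d/ds det ℳ = det ℳ · tr(ℳ⁻¹ℳ′)` at an invertible point), **`hasDerivAt_log_det`** (C1, second
  equality, `𝕜 = ℂ`, positive-definite point: `d/ds log det ℳ = tr(ℳ⁻¹ℳ′)` for the principal complex
  logarithm) and `hasDerivAt_real_log_det` (`𝕜 = ℝ`, `det ≠ 0`);
* §2 the inverse: `differentiableAt_inv_apply`, **`hasDerivAt_inv_apply`**
  (`d/ds (ℳ⁻¹)ᵢⱼ = (−ℳ⁻¹ℳ′ℳ⁻¹)ᵢⱼ` at an invertible point — the middle expression of (C2));
* §3 the pseudofermion force: `hasDerivAt_quadForm_inv` (`d/ds φ†ℳ⁻¹φ = −φ†ℳ⁻¹ℳ′ℳ⁻¹φ`) and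
  **`hasDerivAt_neg_quadForm_inv`** (C2 as printed: `d/ds(−φ†ℳ⁻¹φ) = η†ℳ′η`, `η = ℳ(s₀)⁻¹φ`, at a
  Hermitian invertible point);
* §4 the algebra of (C3): `trace_inv_mul_conjTranspose_mul` (`Tr[(DD†)⁻¹X] = Tr[D⁻¹X(D†)⁻¹]`) and
  `star_dotProduct_of_eta` (`((D†)⁻¹χ)† X (D†)⁻¹χ = χ†(D⁻¹X(D†)⁻¹)χ`), which turn the two-flavour trace
  into a quadratic form in the heat-bath noise.

## Scope (honest)

Finite matrices, one real parameter; positivity is used only where the source uses it (the complex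
logarithm of `det ℳ` at a positive-definite point).  NOT here: the stochastic identity
`E_{χ∼e^{−χ†χ}}[χ†Aχ] = Tr A` (last equalities of (C1) and (C3)) — for REAL unit noises it is the tree's
`Literature.Probability.Moments.StochasticTrace.integral_traceEst`
(`Probability/Moments/StochasticTraceEstimator.lean`); the complex-Gaussian form is left to a sibling
file — and nothing about the cost or variance of the estimator, automatic differentiation, or gauge
fields (`∇` with respect to group-valued links).

## References

* [AlbergoEtAl2021Fermions] M. S. Albergo et al., Phys. Rev. D 104 (2021) 114507, App. C (C1)–(C3).
-/

noncomputable section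

open Filter Finset Equiv
open scoped Topology

namespace Literature.Analysis.Matrix

namespace LogDetDerivative

open _root_.Matrix

variable {𝕜 : Type*} [RCLike 𝕜]
variable {n : Type*} [Fintype n] [DecidableEq n]
variable {M : ℝ → Matrix n n 𝕜} {M' : Matrix n n 𝕜} {s₀ : ℝ}

/-! ## §1 Jacobi's formula along an entrywise differentiable path -/

section Jacobi

/-- **Leibniz-expanded derivative of the determinant** along an entrywise differentiable matrix path:
`d/ds det ℳ(s) = Σ_σ sgn σ Σᵢ (∏_{j ≠ i} ℳ_{σj,j}) ℳ′_{σi,i}` (term-by-term differentiation of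
`det ℳ = Σ_σ sgn σ ∏ᵢ ℳ_{σi,i}`) — the first step of `∇ log det ℳ = Tr[ℳ⁻¹∇ℳ]`. [folklore]
[cite: AlbergoEtAl2021Fermions, App. C eq. (C1) (step: differentiability of det ℳ(φ))] -/
theorem hasDerivAt_det_leibniz (hM : ∀ i j, HasDerivAt (fun s => M s i j) (M' i j) s₀) :
    HasDerivAt (fun s => (M s).det)
      (∑ σ : Perm n, ((Perm.sign σ : ℤ) : 𝕜) *
        ∑ i, (∏ j ∈ univ.erase i, M s₀ (σ j) j) * M' (σ i) i) s₀ := by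
  have hterm : ∀ σ : Perm n, HasDerivAt (fun s => ((Perm.sign σ : ℤ) : 𝕜) * ∏ i, M s (σ i) i)
      (((Perm.sign σ : ℤ) : 𝕜) * ∑ i, (∏ j ∈ univ.erase i, M s₀ (σ j) j) • M' (σ i) i) s₀ := by
    intro σ
    have hp := HasDerivAt.fun_finsetProd (u := univ) (x := s₀)
      (f := fun i s => M s (σ i) i) (f' := fun i => M' (σ i) i) (fun i _ => hM (σ i) i)
    exact hp.const_mul _
  have hsum := HasDerivAt.fun_sum (u := univ) fun σ (_ : σ ∈ univ) => hterm σ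
  have hfun : (fun s => (M s).det) =
      fun s => ∑ σ : Perm n, ((Perm.sign σ : ℤ) : 𝕜) * ∏ i, M s (σ i) i := by
    funext s; rw [det_apply']
  rw [hfun]
  refine hsum.congr_deriv (sum_congr rfl fun σ _ => ?_)
  simp only [smul_eq_mul]

/-- **Jacobi's formula at a point where `ℳ(s₀) = 1`**: `d/ds det ℳ(s)|_{s₀} = tr ℳ′` (only the identity
permutation survives in the Leibniz expansion). [folklore]
[cite: AlbergoEtAl2021Fermions, App. C eq. (C1) (step: ∇ det ℳ = det ℳ · Tr[ℳ⁻¹∇ℳ] at ℳ = 1)] -/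
theorem hasDerivAt_det_of_eq_one (hM : ∀ i j, HasDerivAt (fun s => M s i j) (M' i j) s₀)
    (h1 : M s₀ = 1) : HasDerivAt (fun s => (M s).det) M'.trace s₀ := by
  refine (hasDerivAt_det_leibniz hM).congr_deriv ?_
  rw [h1, sum_eq_single (1 : Perm n)]
  · rw [Perm.sign_one, Units.val_one, Int.cast_one, one_mul]
    have h1' : ∀ i : n, (∏ j ∈ univ.erase i, (1 : Matrix n n 𝕜) ((1 : Perm n) j) j) = 1 :=
      fun i => prod_eq_one fun j _ => one_apply_eq j
    rw [sum_congr rfl fun i _ => by rw [h1' i, one_mul]]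
    rfl
  · intro σ _ hσ
    refine mul_eq_zero_of_right _ (sum_eq_zero fun i _ => ?_)
    -- some `j ≠ i` is moved by `σ`
    obtain ⟨j, hji, hj⟩ : ∃ j, j ≠ i ∧ σ j ≠ j := by
      obtain ⟨j₀, hj₀⟩ : ∃ j₀, σ j₀ ≠ j₀ := not_forall.mp fun h => hσ (Equiv.ext h)
      by_cases hji : j₀ = i
      · subst hji
        exact ⟨σ j₀, hj₀, fun h => hj₀ (σ.injective h)⟩
      · exact ⟨j₀, hji, hj₀⟩
    rw [prod_eq_zero (f := fun j => (1 : Matrix n n 𝕜) (σ j) j) (mem_erase.2 ⟨hji, mem_univ j⟩)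
      (one_apply_ne hj), zero_mul]
  · intro h; exact absurd (mem_univ _) h

/-- The entries of `s ↦ ℳ(s₀)⁻¹ ℳ(s)` are differentiable with derivative `ℳ(s₀)⁻¹ ℳ′`. [folklore] -/
private theorem hasDerivAt_inv_mul_apply (hM : ∀ i j, HasDerivAt (fun s => M s i j) (M' i j) s₀) (i j : n) :
    HasDerivAt (fun s => ((M s₀)⁻¹ * M s) i j) (((M s₀)⁻¹ * M') i j) s₀ := by
  simp only [Matrix.mul_apply]
  exact HasDerivAt.fun_sum fun k _ => (hM k j).const_mul ((M s₀)⁻¹ i k)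

/-- **Jacobi's formula**: at a point where `ℳ(s₀)` is invertible,
`d/ds det ℳ(s)|_{s₀} = det ℳ(s₀) · tr(ℳ(s₀)⁻¹ ℳ′)` (from the case `ℳ(s₀) = 1` applied to
`s ↦ ℳ(s₀)⁻¹ℳ(s)` and `det ℳ(s) = det ℳ(s₀) · det(ℳ(s₀)⁻¹ℳ(s))`). [folklore]
[cite: AlbergoEtAl2021Fermions, App. C eq. (C1) (∇ log det ℳ = Tr[ℳ⁻¹∇ℳ])] -/
theorem hasDerivAt_det (hM : ∀ i j, HasDerivAt (fun s => M s i j) (M' i j) s₀)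
    (hinv : IsUnit (M s₀).det) :
    HasDerivAt (fun s => (M s).det) ((M s₀).det * ((M s₀)⁻¹ * M').trace) s₀ := by
  have hN1 : (M s₀)⁻¹ * M s₀ = 1 := nonsing_inv_mul _ hinv
  have hdetN := hasDerivAt_det_of_eq_one (M := fun s => (M s₀)⁻¹ * M s)
    (hasDerivAt_inv_mul_apply hM) hN1
  have hfun : (fun s => (M s).det) = fun s => (M s₀).det * ((M s₀)⁻¹ * M s).det := by
    funext s
    rw [det_mul, det_nonsing_inv, ← mul_assoc, Ring.mul_inverse_cancel _ hinv, one_mul]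
  rw [hfun]
  exact hdetN.const_mul _

open scoped ComplexOrder in
/-- **`∇ log det ℳ = Tr[ℳ⁻¹ ∇ℳ]`** (C1, second equality) for complex matrices at a positive-definite
point, with the principal branch of the complex logarithm (`det ℳ(s₀)` is a positive real, so
`Complex.log` is differentiable there).
[cite: AlbergoEtAl2021Fermions, App. C eq. (C1) (∇ log det ℳ(φ) = ∇ Tr log ℳ(φ) = Tr[ℳ(φ)⁻¹∇ℳ(φ)])] -/
theorem hasDerivAt_log_det {M : ℝ → Matrix n n ℂ} {M' : Matrix n n ℂ} {s₀ : ℝ}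
    (hM : ∀ i j, HasDerivAt (fun s => M s i j) (M' i j) s₀) (hpos : (M s₀).PosDef) :
    HasDerivAt (fun s => Complex.log (M s).det) ((M s₀)⁻¹ * M').trace s₀ := by
  have hdetpos : 0 < (M s₀).det := hpos.det_pos
  have hre : 0 < (M s₀).det.re := by
    have h := (Complex.lt_def.1 hdetpos).1
    simpa using h
  have hne : (M s₀).det ≠ 0 := fun h => by simp [h] at hre
  have hslit : (M s₀).det ∈ Complex.slitPlane := Complex.mem_slitPlane_iff.2 (Or.inl hre)
  have h := (Complex.hasDerivAt_log hslit).comp s₀ (hasDerivAt_det hM (isUnit_iff_ne_zero.2 hne))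
  refine h.congr_deriv ?_
  rw [← mul_assoc, inv_mul_cancel₀ hne, one_mul]

/-- Real form: for a real matrix path with `det ℳ(s₀) ≠ 0`, `d/ds log det ℳ = tr(ℳ⁻¹ℳ′)` (Mathlib's
`Real.log`, which is `log |·|` off the positive axis). [folklore]
[cite: AlbergoEtAl2021Fermions, App. C eq. (C1)] -/
theorem hasDerivAt_real_log_det {M : ℝ → Matrix n n ℝ} {M' : Matrix n n ℝ} {s₀ : ℝ}
    (hM : ∀ i j, HasDerivAt (fun s => M s i j) (M' i j) s₀) (hne : (M s₀).det ≠ 0) :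
    HasDerivAt (fun s => Real.log (M s).det) ((M s₀)⁻¹ * M').trace s₀ := by
  have h := (Real.hasDerivAt_log hne).comp s₀ (hasDerivAt_det hM (isUnit_iff_ne_zero.2 hne))
  refine h.congr_deriv ?_
  rw [← mul_assoc, inv_mul_cancel₀ hne, one_mul]

end Jacobi

/-! ## §2 The derivative of the inverse: `d/ds ℳ⁻¹ = −ℳ⁻¹ ℳ′ ℳ⁻¹` -/

section Inverse

/-- The entries of the adjugate along an entrywise differentiable path are differentiable (each is the
determinant of a path with one row frozen to a basis vector). [folklore] -/
private theorem differentiableAt_adjugate_apply (hM : ∀ i j, HasDerivAt (fun s => M s i j) (M' i j) s₀)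
    (i j : n) : DifferentiableAt ℝ (fun s => (M s).adjugate i j) s₀ := by
  have hfun : (fun s => (M s).adjugate i j) = fun s => ((M s).updateRow j (Pi.single i 1)).det := by
    funext s; rw [adjugate_apply]
  rw [hfun]
  have hP : ∀ k l, HasDerivAt (fun s => (M s).updateRow j (Pi.single i 1) k l)
      (M'.updateRow j 0 k l) s₀ := by
    intro k l
    by_cases hk : k = j
    · subst hk
      simp only [updateRow_self, Pi.zero_apply]
      exact hasDerivAt_const _ _
    · simp only [updateRow_ne hk]
      exact hM k l
  exact (hasDerivAt_det_leibniz hP).differentiableAt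

/-- The entries of `s ↦ ℳ(s)⁻¹` are differentiable at a point where `ℳ(s₀)` is invertible
(`ℳ⁻¹ = (det ℳ)⁻¹ · adj ℳ`). [folklore]
[cite: AlbergoEtAl2021Fermions, App. C eq. (C2) (step: differentiability of ℳ(φ)⁻¹)] -/
theorem differentiableAt_inv_apply (hM : ∀ i j, HasDerivAt (fun s => M s i j) (M' i j) s₀)
    (hinv : IsUnit (M s₀).det) (i j : n) : DifferentiableAt ℝ (fun s => (M s)⁻¹ i j) s₀ := by
  have hfun : (fun s => (M s)⁻¹ i j) = fun s => Ring.inverse ((M s).det) * (M s).adjugate i j := by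
    funext s
    have h := congrFun (congrFun (inv_def (M s)) i) j
    rw [h, Matrix.smul_apply, smul_eq_mul]
  rw [hfun]
  exact ((hasDerivAt_det_leibniz hM).differentiableAt.inverse hinv).mul
    (differentiableAt_adjugate_apply hM i j)

/-- **`d/ds ℳ(s)⁻¹ = −ℳ⁻¹ ℳ′ ℳ⁻¹`** at a point where `ℳ(s₀)` is invertible, entrywise (differentiate
`ℳ(s)⁻¹ℳ(s) = 1`, valid on a neighbourhood of `s₀` by continuity of `det ℳ(s)`).
[folklore] [cite: AlbergoEtAl2021Fermions, App. C eq. (C2) (∇(−φ†ℳ⁻¹φ) = φ†ℳ⁻¹(∇ℳ)ℳ⁻¹φ)] -/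
theorem hasDerivAt_inv_apply (hM : ∀ i j, HasDerivAt (fun s => M s i j) (M' i j) s₀)
    (hinv : IsUnit (M s₀).det) (i j : n) :
    HasDerivAt (fun s => (M s)⁻¹ i j) ((-((M s₀)⁻¹ * M' * (M s₀)⁻¹)) i j) s₀ := by
  -- the (as yet unknown) derivative matrix of the inverse
  set D : Matrix n n 𝕜 := fun i j => deriv (fun s => (M s)⁻¹ i j) s₀ with hDdef
  have hD : ∀ i j, HasDerivAt (fun s => (M s)⁻¹ i j) (D i j) s₀ := fun i j =>
    (differentiableAt_inv_apply hM hinv i j).hasDerivAt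
  -- product rule for the entries of `ℳ⁻¹ ℳ`
  have hG : ∀ i j, HasDerivAt (fun s => ((M s)⁻¹ * M s) i j) ((D * M s₀ + (M s₀)⁻¹ * M') i j) s₀ := by
    intro i j
    simp only [Matrix.mul_apply, Matrix.add_apply, ← sum_add_distrib]
    exact HasDerivAt.fun_sum fun k _ => (hD i k).mul (hM k j)
  -- `ℳ⁻¹ ℳ = 1` near `s₀`
  have hev : ∀ᶠ s in 𝓝 s₀, (M s)⁻¹ * M s = 1 := by
    have hc : ContinuousAt (fun s => (M s).det) s₀ := (hasDerivAt_det_leibniz hM).continuousAt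
    filter_upwards [hc.eventually_ne hinv.ne_zero] with s hs
    exact nonsing_inv_mul _ (isUnit_iff_ne_zero.mpr hs)
  have hzero : ∀ i j, HasDerivAt (fun s => ((M s)⁻¹ * M s) i j) 0 s₀ := by
    intro i j
    refine (hasDerivAt_const s₀ ((1 : Matrix n n 𝕜) i j)).congr_of_eventuallyEq ?_
    filter_upwards [hev] with s hs
    rw [hs]
  have hmat : D * M s₀ + (M s₀)⁻¹ * M' = 0 := by
    ext i j
    exact (hG i j).unique (hzero i j)
  have hDval : D = -((M s₀)⁻¹ * M' * (M s₀)⁻¹) := by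
    have h1 : D * M s₀ = -((M s₀)⁻¹ * M') := eq_neg_of_add_eq_zero_left hmat
    calc D = D * M s₀ * (M s₀)⁻¹ := (mul_nonsing_inv_cancel_right _ _ hinv).symm
      _ = -((M s₀)⁻¹ * M' * (M s₀)⁻¹) := by rw [h1, Matrix.neg_mul]
  rw [← hDval]
  exact hD i j

end Inverse

/-! ## §3 The pseudofermion force `d/ds(−φ†ℳ⁻¹φ) = η†ℳ′η` -/

section Force

/-- `d/ds (ℳ(s)⁻¹φ)ᵢ = (−ℳ⁻¹ℳ′ℳ⁻¹ φ)ᵢ`. [folklore]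
[cite: AlbergoEtAl2021Fermions, App. C eq. (C2) (step: ∇(ℳ⁻¹φ) = −ℳ⁻¹(∇ℳ)ℳ⁻¹φ)] -/
theorem hasDerivAt_inv_mulVec_apply (hM : ∀ i j, HasDerivAt (fun s => M s i j) (M' i j) s₀)
    (hinv : IsUnit (M s₀).det) (φ : n → 𝕜) (i : n) :
    HasDerivAt (fun s => ((M s)⁻¹ *ᵥ φ) i) ((-((M s₀)⁻¹ * M' * (M s₀)⁻¹) *ᵥ φ) i) s₀ := by
  simp only [Matrix.mulVec, dotProduct]
  exact HasDerivAt.fun_sum fun j _ => (hasDerivAt_inv_apply hM hinv i j).mul_const (φ j)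

/-- **`d/ds φ†ℳ(s)⁻¹φ = −φ† ℳ⁻¹ℳ′ℳ⁻¹ φ`** for a fixed vector `φ`, at an invertible point.
[cite: AlbergoEtAl2021Fermions, App. C eq. (C2) (first equality)] -/
theorem hasDerivAt_quadForm_inv (hM : ∀ i j, HasDerivAt (fun s => M s i j) (M' i j) s₀)
    (hinv : IsUnit (M s₀).det) (φ : n → 𝕜) :
    HasDerivAt (fun s => star φ ⬝ᵥ (M s)⁻¹ *ᵥ φ)
      (-(star φ ⬝ᵥ ((M s₀)⁻¹ * M' * (M s₀)⁻¹) *ᵥ φ)) s₀ := by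
  have h : HasDerivAt (fun s => star φ ⬝ᵥ (M s)⁻¹ *ᵥ φ)
      (star φ ⬝ᵥ (-((M s₀)⁻¹ * M' * (M s₀)⁻¹)) *ᵥ φ) s₀ := by
    simp only [dotProduct]
    exact HasDerivAt.fun_sum fun i _ => (hasDerivAt_inv_mulVec_apply hM hinv φ i).const_mul _
  refine h.congr_deriv ?_
  rw [Matrix.neg_mulVec, dotProduct_neg]

/-- **The pseudofermion force, (C2) as printed**: at a point where `ℳ(s₀)` is Hermitian and invertible
(`ℳ = DD†` in the source), `d/ds (−φ†ℳ(s)⁻¹φ)|_{s₀} = η† ℳ′ η` with `η = ℳ(s₀)⁻¹φ` — one solve gives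
the force. [cite: AlbergoEtAl2021Fermions, App. C eq. (C2)] -/
theorem hasDerivAt_neg_quadForm_inv (hM : ∀ i j, HasDerivAt (fun s => M s i j) (M' i j) s₀)
    (hherm : (M s₀).IsHermitian) (hinv : IsUnit (M s₀).det) (φ : n → 𝕜) :
    HasDerivAt (fun s => -(star φ ⬝ᵥ (M s)⁻¹ *ᵥ φ))
      (star ((M s₀)⁻¹ *ᵥ φ) ⬝ᵥ M' *ᵥ ((M s₀)⁻¹ *ᵥ φ)) s₀ := by
  refine (hasDerivAt_quadForm_inv hM hinv φ).neg.congr_deriv ?_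
  rw [neg_neg, ← mulVec_mulVec, ← mulVec_mulVec, dotProduct_mulVec, star_mulVec, hherm.inv.eq]

end Force

/-! ## §4 The algebra of (C3): the two-flavour trace as a quadratic form in the heat-bath noise -/

section TwoFlavour

/-- **`Tr[(DD†)⁻¹ X] = Tr[D⁻¹ X (D†)⁻¹]`** (`(DD†)⁻¹ = (D†)⁻¹D⁻¹` and cyclicity of the trace).
[cite: AlbergoEtAl2021Fermions, App. C eq. (C3) (first equality)] -/
theorem trace_inv_mul_conjTranspose_mul (D X : Matrix n n 𝕜) :
    ((D * Dᴴ)⁻¹ * X).trace = (D⁻¹ * X * Dᴴ⁻¹).trace := by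
  rw [Matrix.mul_inv_rev, Matrix.mul_assoc, trace_mul_comm, Matrix.mul_assoc]

/-- **`((D†)⁻¹χ)† X ((D†)⁻¹χ) = χ† (D⁻¹ X (D†)⁻¹) χ`**: with `η = (D†)⁻¹χ` the quadratic form `η†Xη` is
the `χ`-quadratic form of the matrix whose trace is `Tr[(DD†)⁻¹X]` — so a unit-noise average of
`η†(∇DD†)η` estimates the two-flavour gradient `Tr[(DD†)⁻¹∇(DD†)]` (stated with Mathlib's total
`Matrix.inv`, so no invertibility hypothesis is needed for the identity itself).
[cite: AlbergoEtAl2021Fermions, App. C eq. (C3) (second and third equalities)] -/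
theorem star_dotProduct_of_eta (D X : Matrix n n 𝕜) (χ : n → 𝕜) :
    star (Dᴴ⁻¹ *ᵥ χ) ⬝ᵥ X *ᵥ (Dᴴ⁻¹ *ᵥ χ) = star χ ⬝ᵥ (D⁻¹ * X * Dᴴ⁻¹) *ᵥ χ := by
  rw [star_mulVec, conjTranspose_nonsing_inv, conjTranspose_conjTranspose]
  simp only [dotProduct_mulVec, vecMul_vecMul, Matrix.mul_assoc]

end TwoFlavour

end LogDetDerivative

end Literature.Analysis.Matrix

end
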